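import Summits.CriticalPhenomena.CardyFormulaZ2.Theorems.CardyIKTransportIKLinearTransportStubCoalescingRowKernelCuts
import Summits.CriticalPhenomena.CardyFormulaZ2.Theorems.CardyIKTransportIKLinearTransportStubCoalescingRowKernelSampler

/-!
# Stub `stub_CoalescingRowKernel` (A_dyn') — part K: THE ROW KERNEL `G` OF THE REDUCTION AND ITS KERNEL
# IDENTITY, from a CUT-MARKOV version of the conditional row law

Support file (`--supports stmt-CriticalPhenomena-5076`, registered sub-goal `crk_kernelIdentity`).

THE HYPOTHESIS the line now posits for (A_dyn') (`CutMarkovKernel S i k`, a structure in `Prop`): a kernel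
`k : (statistic value) → (row value) → ℝ` which is measurable, probability-vector-valued, READS THE PAST
ONLY STRICTLY ABOVE ANY CUT ROW of the environment below row `0` (`IsCut`, `…Cuts.lean`), and is a version
of the conditional law of the middle row `0` of `νmix (S ∆ {i,i+1})` given the row statistic
`rowStat i = (pinnedStat i, pastMid i 0)`:
`ν' {rowStat ∈ A, rowBool = b} = ∫⁻_{rowStat ∈ A} k (rowStat x) b dν'`. (Why true: given the environment
the middle column is (iso-side boundary colour) ⊕ (a stationary two-state Markov chain), with independent
flags; a cut row forces three middle colours, makes the flags of two face rows bichromatic, and — its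
row pair being absent from the diagram — lets every monochromatic strip path be rerouted to one side, so
the diagram constraint factorises and the rows above the cut are conditionally independent of the rows
below given the pinned statistic.)

THE CONSTRUCTION. Levels `crkU` = the i.i.d. uniform levels of `ps_beta_uniform`. Row `0` of
`crkG S i k (t, r)` is the sampled row `crkQ k (t, r)` (`…Sampler.lean`); the rows above are produced by
the TAIL KERNEL `crkTail S i` — `ps3_transfer_kernel` for the statistic `rowStat1 i = (rowStat i, rowBool i)`
with a Lebesgue level — driven by the residual level `crkR k (t, r)`; row `0` of the output is then forced
to the sampled value (`rowBits_crkG`, a sure identity). THE KERNEL IDENTITY (`crk_kernel_identity`,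
registered as `crk_kernelIdentity`): the joint law of (row statistic, sampled row, residual) is
(law of `rowStat1`) ⊗ Lebesgue (`crk_jointLaw`: sections of rectangles `s × (-∞, a]` through the
one-dimensional law and the `law` field, `Measure.ext_of_Iic`, `Measure.ext_prod`), the tail kernel turns
it into the law of `(rowStat1 x, x)`, and overwriting row `0` by its own bits does nothing.
-/

noncomputable section

namespace Summit.CriticalPhenomena.CardyFormulaZ2.Theorems.IKLinearTransport.PinnedDiagramExchange

open scoped Classical MeasureTheory ENNReal symmDiff
open Set MeasureTheory
open Literature.Probability.Percolation Literature.Probability.LatticeModels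
/-! ## Uniform levels, the Lebesgue level space -/

/-- THE LEVELS: i.i.d. uniform levels read from the fresh bits at each cell (`ps_beta_uniform`). [folklore] -/
def crkU : Site 2 → Rnd → ℝ := Classical.choose ps_beta_uniform

/-- Specification of the levels: measurable, cell-local, shift-covariant, uniform. [folklore] -/
theorem crkU_spec : (∀ v, Measurable (crkU v)) ∧
    (∀ v (u u' : Rnd), (∀ k : ℕ, ((v, k) ∈ u ↔ (v, k) ∈ u')) → crkU v u = crkU v u') ∧
    (∀ v (m : ℤ) (u : Rnd), crkU v (ushift m u) = crkU (v - ![0, m]) u) ∧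
    ∀ v, ∀ c ∈ Set.Icc (0 : ℝ) 1, β {u | crkU v u ≤ c} = ENNReal.ofReal c :=
  Classical.choose_spec ps_beta_uniform

/-- `β` is a probability measure. [folklore] -/
theorem crk_isProbabilityMeasure_beta : IsProbabilityMeasure β := by
  rw [show β = sitePercolation (Site 2 × ℕ) half from rfl]; infer_instance

/-- Lebesgue measure on the unit interval (the law of the residual level). [folklore] -/
def crkLeb : Measure ℝ := volume.restrict (Icc (0 : ℝ) 1)

/-- `crkLeb` is a probability measure. [folklore] -/
theorem crk_isProbabilityMeasure_leb : IsProbabilityMeasure crkLeb :=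
  ⟨by simp [crkLeb, Real.volume_Icc]⟩

/-- The distribution function of `crkLeb`. [folklore] -/
theorem crkLeb_Iic (a : ℝ) : crkLeb (Iic a) = ENNReal.ofReal (max 0 (min a 1)) := by
  rw [crkLeb, Measure.restrict_apply measurableSet_Iic]
  rcases lt_or_ge a 0 with ha | ha
  · have : Iic a ∩ Icc (0 : ℝ) 1 = ∅ := by
      ext x; simp only [mem_inter_iff, mem_Iic, mem_Icc, mem_empty_iff_false, iff_false]; intro h; linarith [h.1, h.2.1]
    rw [this, measure_empty, max_eq_left ((min_le_left a 1).trans ha.le), ENNReal.ofReal_zero]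
  · have : Iic a ∩ Icc (0 : ℝ) 1 = Icc 0 (min a 1) := by
      ext x; simp only [mem_inter_iff, mem_Iic, mem_Icc, le_min_iff]; tauto
    rw [this, Real.volume_Icc, sub_zero, max_eq_right (le_min ha zero_le_one)]

/-- The identity level on `crkLeb` is uniform. [folklore] -/
theorem crkLeb_unif : ∀ c ∈ Icc (0 : ℝ) 1, crkLeb {u | id u ≤ c} = ENNReal.ofReal c := by
  intro c hc
  rw [show {u : ℝ | id u ≤ c} = Iic c from rfl, crkLeb_Iic, min_eq_left hc.2, max_eq_right hc.1]

/-! ## The cut-Markov kernel hypothesis and the joint law of (statistic, row, residual) -/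

/-- CUT-MARKOV VERSION OF THE CONDITIONAL ROW LAW (the hypothesis (K) of the reduction; statement the
line POSITS). `k t b` is a probability vector in the row value `b`, measurable in the statistic value
`t = (p, past)`, READS THE PAST ONLY ABOVE ANY CUT ROW of `p` below row `0`, and is a version of the
conditional law of the middle row `0` of `νmix (S ∆ {i,i+1})` given the row statistic
`rowStat i = (pinnedStat i, pastMid i 0)`. [folklore] -/
structure CutMarkovKernel (S : Set ℤ) (i : ℤ)
    (k : (Obs × Set (Site 2 × Site 2)) × Obs → Bool × Bool × Bool → ℝ) : Prop where
  /-- measurable in the statistic value -/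
  measurable : ∀ b, Measurable fun t => k t b
  /-- nonnegative -/
  nonneg : ∀ t b, 0 ≤ k t b
  /-- a probability vector at every statistic value -/
  sum_one : ∀ t, ∑ b, k t b = 1
  /-- reads the past only strictly above a cut row below row `0` -/
  reads : ∀ (p : Obs × Set (Site 2 × Site 2)) (z z' : Obs) (c : ℤ), c ≤ -1 → IsCut i c p →
    (∀ w : Site 2, c + 1 ≤ w 1 → ((w ∈ z.1 ↔ w ∈ z'.1) ∧ (w ∈ z.2 ↔ w ∈ z'.2))) → k (p, z) = k (p, z')
  /-- a version of the conditional law of the middle row `0` given the row statistic -/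
  law : ∀ A : Set ((Obs × Set (Site 2 × Site 2)) × Obs), MeasurableSet A → ∀ b : Bool × Bool × Bool,
    (νmix (S ∆ {i, i + 1})) {x | rowStat i x ∈ A ∧ rowBool i x = b} =
      ∫⁻ x in (rowStat i) ⁻¹' A, ENNReal.ofReal (k (rowStat i x) b) ∂(νmix (S ∆ {i, i + 1}))

section JointLaw

variable (S : Set ℤ) (i : ℤ) (k : (Obs × Set (Site 2 × Site 2)) × Obs → Bool × Bool × Bool → ℝ)

/-- Fibre decomposition of the section of a rectangle under the row sampler. [folklore] -/
theorem crk_section_measure (hk : CutMarkovKernel S i k) {R : Type*} [MeasurableSpace R] (μ : Measure R)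
    [IsProbabilityMeasure μ] {U : R → ℝ} (hU : Measurable U)
    (hunif : ∀ c ∈ Icc (0 : ℝ) 1, μ {u | U u ≤ c} = ENNReal.ofReal c)
    (s : Set (((Obs × Set (Site 2 × Site 2)) × Obs) × (Bool × Bool × Bool)))
    (t : (Obs × Set (Site 2 × Site 2)) × Obs) (a : ℝ) :
    μ {u | (t, crkQ k (t, U u)) ∈ s ∧ crkR k (t, U u) ≤ a} =
      ∑ b, if (t, b) ∈ s then ENNReal.ofReal (max 0 (min a 1) * k t b) else 0 := by
  have hQm : Measurable fun u => crkQ k (t, U u) :=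
    (measurable_crkQ k hk.measurable).comp (measurable_const.prodMk hU)
  set A : Set R := {u | (t, crkQ k (t, U u)) ∈ s ∧ crkR k (t, U u) ≤ a} with hA
  have hfib : ∑ b, (μ.restrict A) ((fun u => crkQ k (t, U u)) ⁻¹' {b}) = μ A := by
    rw [sum_measure_preimage_singleton Finset.univ (fun b _ => hQm (measurableSet_singleton b))]
    simp only [Finset.coe_univ, preimage_univ, Measure.restrict_apply_univ]
  rw [← hfib]
  refine Finset.sum_congr rfl fun b _ => ?_
  rw [Measure.restrict_apply (hQm (measurableSet_singleton b))]
  by_cases hb : (t, b) ∈ s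
  · rw [if_pos hb, ← crk_measure_Q_R' k μ hU hunif t (hk.nonneg t) (hk.sum_one t) b a]
    congr 1
    ext u
    simp only [hA, mem_inter_iff, mem_preimage, mem_singleton_iff, mem_setOf_eq]
    constructor
    · rintro ⟨h1, -, h2⟩; exact ⟨h1, h2⟩
    · rintro ⟨h1, h2⟩; exact ⟨h1, by rw [h1]; exact hb, h2⟩
  · rw [if_neg hb]
    have : ((fun u => crkQ k (t, U u)) ⁻¹' {b}) ∩ A = ∅ := by
      ext u
      simp only [hA, mem_inter_iff, mem_preimage, mem_singleton_iff, mem_setOf_eq, mem_empty_iff_false,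
        iff_false, not_and]
      intro h1 h2; rw [h1] at h2; exact absurd h2 hb
    rw [this, measure_empty]

/-- The map `(x, u) ↦ ((row statistic, sampled row), residual level)`. [folklore] -/
def crkE (q : Obs × Rnd) : (((Obs × Set (Site 2 × Site 2)) × Obs) × (Bool × Bool × Bool)) × ℝ :=
  ((rowStat i q.1, crkQ k (rowStat i q.1, crkU ![i + 1, 0] q.2)), crkR k (rowStat i q.1, crkU ![i + 1, 0] q.2))

/-- `crkE` is measurable. [folklore] -/
theorem measurable_crkE (hk : CutMarkovKernel S i k) : Measurable (crkE i k) := by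
  have h1 : Measurable fun q : Obs × Rnd => (rowStat i q.1, crkU ![i + 1, 0] q.2) :=
    ((measurable_rowStat i).comp measurable_fst).prodMk ((crkU_spec.1 _).comp measurable_snd)
  exact (((measurable_rowStat i).comp measurable_fst).prodMk ((measurable_crkQ k hk.measurable).comp h1)).prodMk
    ((measurable_crkR k hk.measurable).comp h1)

/-- The statistic at row `1`: (row statistic, row-`0` bits). [folklore] -/
def rowStat1 (x : Obs) : ((Obs × Set (Site 2 × Site 2)) × Obs) × (Bool × Bool × Bool) := (rowStat i x, rowBool i x)

/-- `rowStat1` is measurable. [folklore] -/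
theorem measurable_rowStat1 : Measurable (rowStat1 i) := (measurable_rowStat i).prodMk (measurable_rowBool i)

/-- Sum over the row values of the fibres of a measurable event. [folklore] -/
theorem crk_measure_eq_sum_rowBool (μ : Measure Obs) (G : Set Obs) :
    ∑ b, μ (G ∩ {x | rowBool i x = b}) = μ G := by
  have := sum_measure_preimage_singleton (μ := μ.restrict G) Finset.univ
    (fun b _ => measurable_rowBool i (measurableSet_singleton b))
  simp only [Finset.coe_univ, preimage_univ, Measure.restrict_apply_univ] at this
  rw [← this]
  refine Finset.sum_congr rfl fun b _ => ?_
  rw [Measure.restrict_apply (measurable_rowBool i (measurableSet_singleton b)), inter_comm]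
  rfl

/-- THE JOINT LAW of (row statistic, sampled row, residual level) under `νmix (S ∆ {i,i+1}) ⊗ β`: it is
(law of (row statistic, true row)) ⊗ Lebesgue on `[0,1]`, for a cut-Markov kernel. [folklore] -/
theorem crk_jointLaw (hk : CutMarkovKernel S i k) :
    ((νmix (S ∆ {i, i + 1})).prod β).map (crkE i k) = ((νmix (S ∆ {i, i + 1})).map (rowStat1 i)).prod crkLeb := by
  set ν' := νmix (S ∆ {i, i + 1}) with hν'
  haveI : IsProbabilityMeasure ν' := isProbabilityMeasure_nuMix _
  haveI : IsProbabilityMeasure β := crk_isProbabilityMeasure_beta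
  haveI : IsProbabilityMeasure crkLeb := crk_isProbabilityMeasure_leb
  have hE := measurable_crkE S i k hk
  haveI : IsProbabilityMeasure ((ν'.prod β).map (crkE i k)) := Measure.isProbabilityMeasure_map hE.aemeasurable
  have hU := crkU_spec.1 (![i + 1, 0] : Site 2)
  have hunif := crkU_spec.2.2.2 (![i + 1, 0] : Site 2)
  -- the rectangles `s × Iic a`
  have key : ∀ {s : Set (((Obs × Set (Site 2 × Site 2)) × Obs) × (Bool × Bool × Bool))}, MeasurableSet s →
      ∀ a : ℝ, ((ν'.prod β).map (crkE i k)) (s ×ˢ Iic a) = ((ν'.map (rowStat1 i)).prod crkLeb) (s ×ˢ Iic a) := by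
    intro s hs a
    set ca : ℝ := max 0 (min a 1) with hca
    rw [Measure.map_apply hE (hs.prod measurableSet_Iic), Measure.prod_apply (hE (hs.prod measurableSet_Iic)),
      Measure.prod_prod, Measure.map_apply (measurable_rowStat1 i) hs, crkLeb_Iic]
    -- the sections
    have hsec : ∀ x : Obs, β (Prod.mk x ⁻¹' (crkE i k ⁻¹' s ×ˢ Iic a)) =
        ∑ b, if (rowStat i x, b) ∈ s then ENNReal.ofReal (ca * k (rowStat i x) b) else 0 := by
      intro x
      rw [← crk_section_measure S i k hk β hU hunif s (rowStat i x) a]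
      rfl
    simp_rw [hsec]
    -- integrate the finite sum
    have hmeas : ∀ b : Bool × Bool × Bool, Measurable fun x : Obs =>
        if (rowStat i x, b) ∈ s then ENNReal.ofReal (ca * k (rowStat i x) b) else 0 := by
      intro b
      refine Measurable.ite ?_ (((hk.measurable b).comp (measurable_rowStat i)).const_mul ca).ennreal_ofReal
        measurable_const
      exact ((measurable_rowStat i).prodMk measurable_const) hs
    rw [lintegral_finsetSum _ fun b _ => hmeas b]
    have hterm : ∀ b : Bool × Bool × Bool,
        ∫⁻ x, (if (rowStat i x, b) ∈ s then ENNReal.ofReal (ca * k (rowStat i x) b) else 0) ∂ν' =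
          ENNReal.ofReal ca * ν' ((rowStat1 i) ⁻¹' s ∩ {x | rowBool i x = b}) := by
      intro b
      set Ab : Set ((Obs × Set (Site 2 × Site 2)) × Obs) := {t | (t, b) ∈ s} with hAb
      have hAbm : MeasurableSet Ab := (measurable_id.prodMk measurable_const) hs
      have h1 : (fun x => if (rowStat i x, b) ∈ s then ENNReal.ofReal (ca * k (rowStat i x) b) else 0) =
          ((rowStat i) ⁻¹' Ab).indicator fun x => ENNReal.ofReal ca * ENNReal.ofReal (k (rowStat i x) b) := by
        funext x
        simp only [indicator, mem_preimage, hAb, mem_setOf_eq]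
        split_ifs
        · rw [ENNReal.ofReal_mul (by positivity)]
        · rfl
      have hm : Measurable fun x : Obs => ENNReal.ofReal (k (rowStat i x) b) :=
        ((hk.measurable b).comp (measurable_rowStat i)).ennreal_ofReal
      rw [h1, lintegral_indicator ((measurable_rowStat i) hAbm), lintegral_const_mul _ hm, ← hk.law Ab hAbm b]
      congr 1
      show ν' _ = ν' _
      congr 1
      ext x
      simp only [hAb, rowStat1, mem_setOf_eq, mem_inter_iff, mem_preimage]
      constructor
      · rintro ⟨h1, h2⟩; exact ⟨by rw [h2]; exact h1, h2⟩
      · rintro ⟨h1, h2⟩; exact ⟨by rw [← h2]; exact h1, h2⟩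
    simp_rw [hterm]
    rw [← Finset.mul_sum, crk_measure_eq_sum_rowBool i ν' ((rowStat1 i) ⁻¹' s), mul_comm]
  -- from rectangles `s × Iic a` to all rectangles
  refine Measure.ext_prod fun {s} {tt} hs htt => ?_
  have h12 : (((ν'.prod β).map (crkE i k)).restrict (s ×ˢ univ)).snd =
      ((((ν'.map (rowStat1 i)).prod crkLeb)).restrict (s ×ˢ univ)).snd :=
    Measure.ext_of_Iic _ _ fun a => by
      rw [ps_snd_restrict_prod_univ_apply _ s measurableSet_Iic,
        ps_snd_restrict_prod_univ_apply _ s measurableSet_Iic, key hs a]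
  have := congrArg (fun μ : Measure ℝ => μ tt) h12
  simpa only [ps_snd_restrict_prod_univ_apply _ s htt] using this

end JointLaw

/-! ## The tail kernel and the row kernel `G` -/

/-- `Set (Site 2)` is standard Borel (a countable product of finite spaces). [folklore] -/
theorem crk_standardBorel : StandardBorelSpace (Set (Site 2)) :=
  inferInstanceAs (StandardBorelSpace (Site 2 → Prop))

section Kernel

variable (S : Set ℤ) (i : ℤ) (k : (Obs × Set (Site 2 × Site 2)) × Obs → Bool × Bool × Bool → ℝ)

/-- THE TAIL KERNEL EXISTS: a measurable function of (statistic at row `1`, level) reproducing the law of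
the configuration jointly with the statistic at row `1`, the level being Lebesgue on `[0,1]`
(`ps3_transfer_kernel`). [folklore] -/
theorem crk_exists_tail : ∃ G' : ((((Obs × Set (Site 2 × Site 2)) × Obs) × (Bool × Bool × Bool)) × ℝ) → Obs,
    Measurable G' ∧ ((νmix (S ∆ {i, i + 1})).prod crkLeb).map
      (fun p => (rowStat1 i p.1, G' (rowStat1 i p.1, p.2))) = (νmix (S ∆ {i, i + 1})).map fun x => (rowStat1 i x, x) := by
  haveI : IsProbabilityMeasure crkLeb := crk_isProbabilityMeasure_leb
  haveI : IsProbabilityMeasure (νmix (S ∆ {i, i + 1})) := isProbabilityMeasure_nuMix _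
  haveI : StandardBorelSpace (Set (Site 2)) := crk_standardBorel
  exact ps3_transfer_kernel (measurable_rowStat1 i) _ measurable_id crkLeb_unif

/-- THE TAIL KERNEL (a choice). [folklore] -/
def crkTail : ((((Obs × Set (Site 2 × Site 2)) × Obs) × (Bool × Bool × Bool)) × ℝ) → Obs :=
  Classical.choose (crk_exists_tail S i)

/-- Specification of the tail kernel. [folklore] -/
theorem crkTail_spec : Measurable (crkTail S i) ∧ ((νmix (S ∆ {i, i + 1})).prod crkLeb).map
    (fun p => (rowStat1 i p.1, crkTail S i (rowStat1 i p.1, p.2))) =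
      (νmix (S ∆ {i, i + 1})).map fun x => (rowStat1 i x, x) :=
  Classical.choose_spec (crk_exists_tail S i)

/-- THE ROW KERNEL `G` OF THE REDUCTION: row `0` from the cut-Markov kernel by the row sampler, the rows
above from the tail kernel driven by the residual level; row `0` of the output is FORCED to the sampled
value (a sure identity, used by coalescence). [folklore] -/
def crkG (q : ((Obs × Set (Site 2 × Site 2)) × Obs) × ℝ) : Obs :=
  setMid i 0 (crkTail S i ((q.1, crkQ k q), crkR k q)) (toProp (crkQ k q))

/-- `crkG` is measurable. [folklore] -/
theorem measurable_crkG (hk : CutMarkovKernel S i k) : Measurable (crkG S i k) := by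
  have hQ := measurable_crkQ k hk.measurable
  have hP : Measurable fun b : Bool × Bool × Bool => toProp b := measurable_of_countable _
  refine (measurable_setMid i 0).comp (Measurable.prodMk ?_ (hP.comp hQ))
  exact (crkTail_spec S i).1.comp ((measurable_fst.prodMk hQ).prodMk (measurable_crkR k hk.measurable))

/-- The row-`0` bits of `crkG` are the sampled row. [folklore] -/
theorem rowBits_crkG (q : ((Obs × Set (Site 2 × Site 2)) × Obs) × ℝ) :
    rowBits i 0 (crkG S i k q) = toProp (crkQ k q) := by
  obtain ⟨h1, h2, h3⟩ := rowBits_setMid i 0 (crkTail S i ((q.1, crkQ k q), crkR k q)) (toProp (crkQ k q))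
  exact Prod.ext (propext h1) (Prod.ext (propext h2) (propext h3))

/-- THE KERNEL IDENTITY for `crkG`: `law (rowStat x, G (rowStat x, U u)) = law (rowStat x, x)` under
`νmix (S ∆ {i,i+1}) ⊗ β`, for a cut-Markov kernel. [folklore] -/
theorem crk_kernel_identity (hk : CutMarkovKernel S i k) :
    ((νmix (S ∆ {i, i + 1})).prod β).map
        (fun xu => (rowStat i xu.1, crkG S i k (rowStat i xu.1, crkU ![i + 1, 0] xu.2))) =
      (νmix (S ∆ {i, i + 1})).map (fun x => (rowStat i x, x)) := by
  set ν' := νmix (S ∆ {i, i + 1}) with hν'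
  haveI : IsProbabilityMeasure ν' := isProbabilityMeasure_nuMix _
  haveI : IsProbabilityMeasure β := crk_isProbabilityMeasure_beta
  haveI : IsProbabilityMeasure crkLeb := crk_isProbabilityMeasure_leb
  obtain ⟨hTm, hTlaw⟩ := crkTail_spec S i
  have hE := measurable_crkE S i k hk
  have hQ := measurable_crkQ k hk.measurable
  have hP : Measurable fun b : Bool × Bool × Bool => toProp b := measurable_of_countable _
  -- `K (y, s) = (y, tail (y, s))` and `H' (y, x') = (y.1, setMid x' (toProp y.2))`
  set K : ((((Obs × Set (Site 2 × Site 2)) × Obs) × (Bool × Bool × Bool)) × ℝ) →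
      ((((Obs × Set (Site 2 × Site 2)) × Obs) × (Bool × Bool × Bool)) × Obs) := fun ys => (ys.1, crkTail S i ys) with hK
  set H' : ((((Obs × Set (Site 2 × Site 2)) × Obs) × (Bool × Bool × Bool)) × Obs) →
      ((Obs × Set (Site 2 × Site 2)) × Obs) × Obs := fun yx => (yx.1.1, setMid i 0 yx.2 (toProp yx.1.2)) with hH'
  have hKm : Measurable K := measurable_fst.prodMk hTm
  have hH'm : Measurable H' :=
    (measurable_fst.comp measurable_fst).prodMk ((measurable_setMid i 0).comp
      (measurable_snd.prodMk (hP.comp (measurable_snd.comp measurable_fst))))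
  -- the map of the statement factors as `H' ∘ K ∘ crkE`
  have hfac : (fun xu : Obs × Rnd => (rowStat i xu.1, crkG S i k (rowStat i xu.1, crkU ![i + 1, 0] xu.2))) =
      (H' ∘ K) ∘ crkE i k := by
    funext xu; rfl
  -- the law of `K` under (law of rowStat1) ⊗ Leb
  have hKlaw : ((ν'.map (rowStat1 i)).prod crkLeb).map K = ν'.map fun x => (rowStat1 i x, x) := by
    have h1 : (ν'.map (rowStat1 i)).prod crkLeb = (ν'.prod crkLeb).map (Prod.map (rowStat1 i) id) := by
      rw [← Measure.map_prod_map _ _ (measurable_rowStat1 i) measurable_id, Measure.map_id]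
    rw [h1, Measure.map_map hKm ((measurable_rowStat1 i).prodMap measurable_id)]
    exact hTlaw
  have hJ : Measurable fun x : Obs => (rowStat1 i x, x) := (measurable_rowStat1 i).prodMk measurable_id
  rw [hfac, ← Measure.map_map (hH'm.comp hKm) hE, crk_jointLaw S i k hk, ← Measure.map_map hH'm hKm, hKlaw,
    Measure.map_map hH'm hJ]
  congr 1
  funext x
  show (rowStat i x, setMid i 0 x (toProp (rowBool i x))) = (rowStat i x, x)
  rw [setMid_toProp_rowBool]

end Kernel


/-! ## The registered form -/

/-- THE KERNEL IDENTITY OF THE REDUCTION'S ROW KERNEL (registered sub-goal `crk_kernelIdentity`): for a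
cut-Markov version `k` of the conditional row law, the row kernel `crkG S i k` driven by the uniform level
`crkU (i+1, 0)` reproduces the law of the configuration jointly with the row statistic. [folklore] -/
theorem crk_kernelIdentity : ∀ (S : Set ℤ) (i : ℤ)
    (k : (Obs × Set (Site 2 × Site 2)) × Obs → Bool × Bool × Bool → ℝ), CutMarkovKernel S i k →
    ((νmix (S ∆ {i, i + 1})).prod β).map
        (fun xu => (rowStat i xu.1, crkG S i k (rowStat i xu.1, crkU ![i + 1, 0] xu.2))) =
      (νmix (S ∆ {i, i + 1})).map (fun x => (rowStat i x, x)) :=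
  fun S i k hk => crk_kernel_identity S i k hk

end Summit.CriticalPhenomena.CardyFormulaZ2.Theorems.IKLinearTransport.PinnedDiagramExchange
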